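import Mathlib.MeasureTheory.Integral.IntegralEqImproper
import Mathlib.MeasureTheory.Function.JacobianOneDim
import Mathlib.Analysis.SpecialFunctions.ImproperIntegrals
import Mathlib.MeasureTheory.Integral.DominatedConvergence
import Mathlib.Analysis.SpecialFunctions.Gaussian.GaussianIntegral
import HarnessLib

/-!
# Exponential-tail convolution: the one-coordinate step of the elementary (monomial) integrals

Proved analytic core of the induction on the number of variables in the asymptotics of the
elementary integrals of Arnold–Gusein-Zade–Varchenko II §7.2 ("Theorem 7.1 can be proved without
difficulty by induction on `n`") and of Lin's Proposition 2.1 (real log-canonical threshold of a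
monomial), written in logarithmic coordinates `x = e^{-y}`.

For a profile `F : ℝ → ℝ` (the weighted sublevel volume of the previous variables as a function of
`s = log 1/t`) and a new variable with weight exponent `ω > 0` and monomial exponent `k > 0`, the
new profile is the exponential convolution

  `expConv ω k F s = ∫_{y>0} e^{-ω y} F (s - k y) dy`.

Writing `r = ω / k` and assuming `F` bounded, `0 ≤ F ≤ P`, we prove the three cases of the step
(`s → +∞`):

* `tendsto_expConv_of_lt` : if `e^{rσ} F(σ)` is integrable (the case `r <` decay rate of `F`, or `F`
  vanishing for `σ > 0`) then `expConv ω k F s · e^{r s} → (1/k) ∫ e^{rσ} F(σ) dσ > 0`;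
* `tendsto_expConv_of_gt` : if `F(σ) e^{λσ}/σ^m → C` with `λ < r` then
  `expConv ω k F s · e^{λ s}/s^m → C/(ω - kλ)`;
* `tendsto_expConv_of_eq` : if `F(σ) e^{rσ}/σ^m → C` then
  `expConv ω k F s · e^{r s}/s^{m+1} → C/(k(m+1))`.

These are exactly the rules `(λ, θ) ↦ (min(r, λ), ·)` for the real log-canonical threshold and its
multiplicity when a variable is added (Lin 2017, Prop. 2.1). Everything here is PROVED; `expConv` is
only a name used in this docstring for the explicit integral; no definitions, no named facts.

## References

* V. I. Arnold, S. M. Gusein-Zade, A. N. Varchenko, *Singularities of Differentiable Maps II*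
  (2012), Part II §7.2 (elementary integrals), Thm. 7.1, Lemma 7.3, Thm. 7.3.
  [ArnoldGuseinzadeVarchenko2012]
* S. Lin, *Algebraic methods for evaluating integrals in Bayesian statistics*, arXiv:1003.5338,
  Prop. 2.1. [Lin2017]
-/

noncomputable section

open MeasureTheory Filter Set Topology

namespace Literature.Analysis.Asymptotics.ExpTail

/-! Throughout, the exponential convolution of the module docstring is written out:
`expConv ω k F s := ∫ y in Ioi 0, exp (-(ω * y)) * F (s - k * y)` (kept as an explicit integral,
no definition is introduced). -/

section Basic

variable {ω k P : ℝ} {F : ℝ → ℝ}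

/-- `∫_{y>0} P e^{-ωy} dy` is finite. [folklore] -/
theorem integrableOn_const_mul_exp_neg (hω : 0 < ω) (P : ℝ) :
    IntegrableOn (fun y => P * Real.exp (-(ω * y))) (Ioi (0 : ℝ)) := by
  refine IntegrableOn.congr_fun (f := fun y => P * Real.exp (-ω * y))
    ((exp_neg_integrableOn_Ioi 0 hω).const_mul P) (fun y _ => ?_) measurableSet_Ioi
  simp only [neg_mul]

/-- `∫_{y>0} e^{-ωy} dy = 1/ω`. [folklore] -/
theorem integral_exp_neg_mul_Ioi (hω : 0 < ω) :
    ∫ y in Ioi (0 : ℝ), Real.exp (-(ω * y)) = 1 / ω := by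
  have h := integral_exp_mul_Ioi (neg_neg_iff_pos.2 hω) 0
  simp only [mul_zero, Real.exp_zero] at h
  rw [show (fun y : ℝ => Real.exp (-(ω * y))) = fun y => Real.exp (-ω * y) from
    funext fun y => by rw [neg_mul], h]
  field_simp

/-- The integrand of `expConv` is integrable for a bounded measurable non-negative profile.
[folklore] -/
theorem integrableOn_integrand (hω : 0 < ω) (hFm : Measurable F) (hF0 : ∀ σ, 0 ≤ F σ)
    (hFP : ∀ σ, F σ ≤ P) (s : ℝ) :
    IntegrableOn (fun y => Real.exp (-(ω * y)) * F (s - k * y)) (Ioi 0) := by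
  refine Integrable.mono' (integrableOn_const_mul_exp_neg hω P) ?_ ?_
  · exact Measurable.aestronglyMeasurable (by fun_prop)
  · filter_upwards with y
    rw [Real.norm_eq_abs, abs_of_nonneg (mul_nonneg (Real.exp_pos _).le (hF0 _)), mul_comm]
    exact mul_le_mul_of_nonneg_right (hFP _) (Real.exp_pos _).le

/-- `expConv ω k F s ≥ 0` for `F ≥ 0`. [folklore] -/
theorem expConv_nonneg (hF0 : ∀ σ, 0 ≤ F σ) (s : ℝ) :
    0 ≤ ∫ y in Ioi (0 : ℝ), Real.exp (-(ω * y)) * F (s - k * y) :=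
  setIntegral_nonneg measurableSet_Ioi fun _ _ => mul_nonneg (Real.exp_pos _).le (hF0 _)

/-- `expConv ω k F s ≤ P / ω` for `0 ≤ F ≤ P`. [folklore] -/
theorem expConv_le (hω : 0 < ω) (hFm : Measurable F) (hF0 : ∀ σ, 0 ≤ F σ) (hFP : ∀ σ, F σ ≤ P)
    (s : ℝ) : (∫ y in Ioi (0 : ℝ), Real.exp (-(ω * y)) * F (s - k * y)) ≤ P / ω := by
  calc (∫ y in Ioi (0 : ℝ), Real.exp (-(ω * y)) * F (s - k * y))
        ≤ ∫ y in Ioi (0 : ℝ), P * Real.exp (-(ω * y)) := by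
        refine setIntegral_mono_on (integrableOn_integrand hω hFm hF0 hFP s)
          (integrableOn_const_mul_exp_neg hω P) measurableSet_Ioi fun _ _ => ?_
        rw [mul_comm]
        exact mul_le_mul_of_nonneg_right (hFP _) (Real.exp_pos _).le
    _ = P / ω := by
        rw [integral_const_mul, integral_exp_neg_mul_Ioi hω]
        field_simp

/-- `expConv` of an antitone profile is antitone (for `k ≥ 0`). [folklore] -/
theorem expConv_antitone (hω : 0 < ω) (hFa : Antitone F) (hF0 : ∀ σ, 0 ≤ F σ)
    (hFP : ∀ σ, F σ ≤ P) :
    Antitone (fun s => ∫ y in Ioi (0 : ℝ), Real.exp (-(ω * y)) * F (s - k * y)) := by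
  intro s₁ s₂ h
  dsimp only
  refine setIntegral_mono_on (integrableOn_integrand hω hFa.measurable hF0 hFP s₂)
    (integrableOn_integrand hω hFa.measurable hF0 hFP s₁) measurableSet_Ioi fun y _ => ?_
  exact mul_le_mul_of_nonneg_left (hFa (by linarith)) (Real.exp_pos _).le

/-- If `F = P` on `(-∞, 0]` and `k ≥ 0` then `expConv ω k F s = P/ω` for `s ≤ 0`. [folklore] -/
theorem expConv_of_nonpos (hω : 0 < ω) (hk : 0 ≤ k) (hFP : ∀ σ, σ ≤ 0 → F σ = P) {s : ℝ}
    (hs : s ≤ 0) : (∫ y in Ioi (0 : ℝ), Real.exp (-(ω * y)) * F (s - k * y)) = P / ω := by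
  calc (∫ y in Ioi (0 : ℝ), Real.exp (-(ω * y)) * F (s - k * y))
        = ∫ y in Ioi (0 : ℝ), P * Real.exp (-(ω * y)) := by
          refine setIntegral_congr_fun measurableSet_Ioi fun y hy => ?_
          rw [hFP _ (by nlinarith [le_of_lt (show (0 : ℝ) < y from hy)]), mul_comm]
    _ = P / ω := by
          rw [integral_const_mul, integral_exp_neg_mul_Ioi hω]
          field_simp

end Basic

/-! ## Case `r` below the decay rate of `F` -/

section CaseLT

variable {ω k P : ℝ} {F : ℝ → ℝ}

/-- Affine change of variables `σ = s - k y`: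
`expConv ω k F s = (e^{-rs}/k) ∫_{σ < s} e^{rσ} F(σ) dσ`, `r = ω/k`. [folklore] -/
theorem expConv_eq_exp_mul_setIntegral (hk : 0 < k) (F : ℝ → ℝ) (s : ℝ) :
    (∫ y in Ioi (0 : ℝ), Real.exp (-(ω * y)) * F (s - k * y)) =
      Real.exp (-(ω / k * s)) / k * ∫ σ in Iio s, Real.exp (ω / k * σ) * F σ := by
  have himage : (fun y => s - k * y) '' Ioi (0 : ℝ) = Iio s := by
    ext σ
    constructor
    · rintro ⟨y, hy, rfl⟩
      simp only [mem_Ioi] at hy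
      simp only [mem_Iio, sub_lt_self_iff]
      positivity
    · intro hσ
      refine ⟨(s - σ) / k, ?_, ?_⟩
      · simp only [mem_Iio] at hσ
        simp only [mem_Ioi]
        exact div_pos (by linarith) hk
      · field_simp
        ring
  have hderiv : ∀ y ∈ Ioi (0 : ℝ), HasDerivWithinAt (fun y => s - k * y) (-k) (Ioi 0) y :=
    fun y _ => by
      simpa using (((hasDerivAt_id y).const_mul k).const_sub s).hasDerivWithinAt
  have hinj : InjOn (fun y => s - k * y) (Ioi (0 : ℝ)) := fun a _ b _ h => by
    simpa [hk.ne', sub_right_inj, mul_eq_mul_left_iff] using h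
  have h := integral_image_eq_integral_abs_deriv_smul measurableSet_Ioi hderiv hinj
    (fun σ => Real.exp (ω / k * σ) * F σ)
  rw [himage] at h
  rw [h, ← integral_const_mul]
  refine setIntegral_congr_fun measurableSet_Ioi fun y _ => ?_
  simp only [smul_eq_mul, abs_neg, abs_of_pos hk]
  have he : Real.exp (-(ω * y)) = Real.exp (-(ω / k * s)) * Real.exp (ω / k * (s - k * y)) := by
    rw [← Real.exp_add]
    congr 1
    field_simp
    ring
  rw [he]
  field_simp

/-- **Step, case `r = ω/k` below the decay rate.** If `σ ↦ e^{rσ} F(σ)` is integrable on `ℝ`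
(`0 ≤ F`, and `F = P > 0` on `σ ≤ 0`), then `M = ∫ e^{rσ}F(σ)dσ > 0` and
`expConv ω k F s · e^{rs} → M/k` as `s → ∞` (new exponent pair `(r, 1)`).
[cite: Lin2017, Prop. 2.1] -/
theorem tendsto_expConv_of_lt (hk : 0 < k) (hF0 : ∀ σ, 0 ≤ F σ)
    (hFP : ∀ σ, σ ≤ 0 → F σ = P) (hP : 0 < P)
    (hint : Integrable (fun σ => Real.exp (ω / k * σ) * F σ)) :
    0 < ∫ σ, Real.exp (ω / k * σ) * F σ ∧
    Tendsto (fun s => (∫ y in Ioi (0 : ℝ), Real.exp (-(ω * y)) * F (s - k * y)) *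
      Real.exp (ω / k * s)) atTop
      (𝓝 ((∫ σ, Real.exp (ω / k * σ) * F σ) / k)) := by
  have hnn : ∀ σ, 0 ≤ Real.exp (ω / k * σ) * F σ :=
    fun σ => mul_nonneg (Real.exp_pos _).le (hF0 σ)
  refine ⟨?_, ?_⟩
  · rw [integral_pos_iff_support_of_nonneg hnn hint]
    have hsub : Iic (0 : ℝ) ⊆ Function.support fun σ => Real.exp (ω / k * σ) * F σ := by
      intro σ hσ
      rw [Function.mem_support, hFP σ hσ]
      exact (mul_pos (Real.exp_pos _) hP).ne'
    refine lt_of_lt_of_le ?_ (measure_mono hsub)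
    simp
  · have hmono : Tendsto (fun s : ℝ => ∫ σ in Iio s, Real.exp (ω / k * σ) * F σ) atTop
        (𝓝 (∫ σ, Real.exp (ω / k * σ) * F σ)) := by
      have h := tendsto_setIntegral_of_monotone (μ := volume) (s := fun s : ℝ => Iio s)
        (fun s => measurableSet_Iio) (fun a b hab => Iio_subset_Iio hab)
        (by rw [iUnion_Iio]; exact hint.integrableOn)
      simpa only [iUnion_Iio, Measure.restrict_univ] using h
    refine (hmono.div_const k).congr' (Eventually.of_forall fun s => ?_)
    dsimp only
    rw [expConv_eq_exp_mul_setIntegral hk F s, Real.exp_neg]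
    field_simp

/-- Integrability of `e^{rσ}F(σ)` from an exponential-polynomial decay bound with a larger rate:
`0 ≤ F ≤ P` and `F(σ) ≤ K σ^m e^{-λσ}` for `σ ≥ σ₀ ≥ 0` with `r < λ`. [folklore] -/
theorem integrable_exp_mul_of_decay {r lam K σ₀ : ℝ} {m : ℕ} (hr : 0 < r) (hrl : r < lam)
    (hσ₀ : 0 ≤ σ₀) (hFm : Measurable F) (hF0 : ∀ σ, 0 ≤ F σ) (hFP : ∀ σ, F σ ≤ P)
    (hdec : ∀ σ, σ₀ ≤ σ → F σ ≤ K * σ ^ m * Real.exp (-(lam * σ))) :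
    Integrable (fun σ => Real.exp (r * σ) * F σ) := by
  have hmeas : AEStronglyMeasurable (fun σ => Real.exp (r * σ) * F σ) volume :=
    Measurable.aestronglyMeasurable (by fun_prop)
  rw [← integrableOn_univ, ← Iic_union_Ioi (a := σ₀), integrableOn_union]
  constructor
  · -- on `(-∞, σ₀]`: bounded by `P e^{rσ}`
    refine Integrable.mono' ((integrableOn_exp_mul_Iic hr σ₀).const_mul P)
      hmeas.restrict ?_
    filter_upwards with σ
    rw [Real.norm_eq_abs, abs_of_nonneg (mul_nonneg (Real.exp_pos _).le (hF0 σ)), mul_comm P]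
    exact mul_le_mul_of_nonneg_left (hFP σ) (Real.exp_pos _).le
  · -- on `(σ₀, ∞)`: bounded by `K σ^m e^{-(λ-r)σ}`
    have hgi : IntegrableOn (fun σ : ℝ => σ ^ (m : ℝ) * Real.exp (-(lam - r) * σ ^ (1 : ℝ)))
        (Ioi 0) :=
      integrableOn_rpow_mul_exp_neg_mul_rpow (neg_one_lt_zero.trans_le (Nat.cast_nonneg m)) le_rfl
        (by linarith)
    have hgi' : IntegrableOn (fun σ : ℝ => K * (σ ^ m * Real.exp (-((lam - r) * σ))))
        (Ioi σ₀) := by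
      refine ((hgi.mono_set (Ioi_subset_Ioi hσ₀)).congr_fun (fun σ _ => ?_)
        measurableSet_Ioi).const_mul K
      rw [Real.rpow_natCast, Real.rpow_one, neg_mul]
    refine Integrable.mono' hgi' hmeas.restrict ?_
    rw [ae_restrict_iff' measurableSet_Ioi]
    filter_upwards with σ hσ
    have hσ' : σ₀ ≤ σ := le_of_lt hσ
    rw [Real.norm_eq_abs, abs_of_nonneg (mul_nonneg (Real.exp_pos _).le (hF0 σ))]
    calc Real.exp (r * σ) * F σ ≤ Real.exp (r * σ) * (K * σ ^ m * Real.exp (-(lam * σ))) :=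
          mul_le_mul_of_nonneg_left (hdec σ hσ') (Real.exp_pos _).le
      _ = K * (σ ^ m * Real.exp (-((lam - r) * σ))) := by
          have : Real.exp (-((lam - r) * σ)) = Real.exp (r * σ) * Real.exp (-(lam * σ)) := by
            rw [← Real.exp_add]
            congr 1
            ring
          rw [this]
          ring

end CaseLT

/-! ## Ratio bounds from the asymptotic hypothesis -/

section Ratio

variable {F : ℝ → ℝ} {lam C : ℝ} {m : ℕ}

/-- From `F(σ) e^{λσ}/σ^m → C`: beyond some `σ₀ ≥ 1` the ratio is within `1` of `C`. [folklore] -/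
theorem exists_ratio_near (hR : Tendsto (fun σ => F σ * Real.exp (lam * σ) / σ ^ m) atTop (𝓝 C)) :
    ∃ σ₀ : ℝ, 1 ≤ σ₀ ∧ ∀ σ, σ₀ ≤ σ → |F σ * Real.exp (lam * σ) / σ ^ m - C| ≤ 1 := by
  obtain ⟨N, hN⟩ := Metric.tendsto_atTop.1 hR 1 one_pos
  refine ⟨max N 1, le_max_right _ _, fun σ hσ => ?_⟩
  have h := hN σ ((le_max_left _ _).trans hσ)
  rw [Real.dist_eq] at h
  exact h.le

/-- The profile in terms of its ratio: `F(σ) = (F(σ)e^{λσ}/σ^m) σ^m e^{-λσ}` for `σ > 0`.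
[folklore] -/
theorem eq_ratio_mul {σ : ℝ} (hσ : 0 < σ) :
    F σ = F σ * Real.exp (lam * σ) / σ ^ m * σ ^ m * Real.exp (-(lam * σ)) := by
  rw [Real.exp_neg]
  field_simp

/-- Decay bound from the ratio bound: `F(σ) ≤ (|C|+1) σ^m e^{-λσ}` for `σ ≥ σ₀`. [folklore] -/
theorem le_of_ratio_near {σ₀ : ℝ} (hσ₀ : 1 ≤ σ₀)
    (h : ∀ σ, σ₀ ≤ σ → |F σ * Real.exp (lam * σ) / σ ^ m - C| ≤ 1) {σ : ℝ} (hσ : σ₀ ≤ σ) :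
    F σ ≤ (|C| + 1) * σ ^ m * Real.exp (-(lam * σ)) := by
  have hσpos : 0 < σ := by linarith
  have hRle : F σ * Real.exp (lam * σ) / σ ^ m ≤ |C| + 1 := by
    have h1 := h σ hσ
    have h2 : F σ * Real.exp (lam * σ) / σ ^ m - C ≤ 1 := (le_abs_self _).trans h1
    linarith [le_abs_self C]
  calc F σ = F σ * Real.exp (lam * σ) / σ ^ m * σ ^ m * Real.exp (-(lam * σ)) := eq_ratio_mul hσpos
    _ ≤ (|C| + 1) * σ ^ m * Real.exp (-(lam * σ)) := by
        gcongr

/-- Absolute ratio bound: `|F(σ) e^{λσ}/σ^m| ≤ |C| + 1` for `σ ≥ σ₀`. [folklore] -/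
theorem abs_ratio_le {σ₀ : ℝ}
    (h : ∀ σ, σ₀ ≤ σ → |F σ * Real.exp (lam * σ) / σ ^ m - C| ≤ 1) {σ : ℝ} (hσ : σ₀ ≤ σ) :
    |F σ * Real.exp (lam * σ) / σ ^ m| ≤ |C| + 1 := by
  have h1 := h σ hσ
  calc |F σ * Real.exp (lam * σ) / σ ^ m| = |(F σ * Real.exp (lam * σ) / σ ^ m - C) + C| := by
        rw [sub_add_cancel]
    _ ≤ |F σ * Real.exp (lam * σ) / σ ^ m - C| + |C| := abs_add_le _ _
    _ ≤ |C| + 1 := by linarith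

end Ratio

/-! ## Case `r` above the decay rate of `F` -/

section CaseGT

variable {ω k P lam C : ℝ} {m : ℕ} {F : ℝ → ℝ}

/-- `∫_{y ≥ a} e^{-ωy} dy = e^{-ωa}/ω` over `(0,∞)` for `a > 0`. [folklore] -/
theorem integral_indicator_Ici_exp_neg (hω : 0 < ω) {a : ℝ} (ha : 0 < a) (Q : ℝ) :
    ∫ y in Ioi (0 : ℝ), (Ici a).indicator (fun y => Q * Real.exp (-(ω * y))) y =
      Q * (Real.exp (-(ω * a)) / ω) := by
  rw [integral_indicator measurableSet_Ici, Measure.restrict_restrict measurableSet_Ici,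
    (inter_eq_left (s := Ici a) (t := Ioi 0)).2 (fun y hy => mem_Ioi.2 (ha.trans_le hy)),
    integral_const_mul, integral_Ici_eq_integral_Ioi]
  have h := integral_exp_mul_Ioi (neg_neg_iff_pos.2 hω) a
  rw [show (fun y : ℝ => Real.exp (-(ω * y))) = fun y => Real.exp (-ω * y) from
    funext fun y => by rw [neg_mul], h, neg_mul, neg_div_neg_eq]

/-- **Step, case `r = ω/k` above the decay rate `λ` of `F`.** If `0 ≤ F ≤ P` is measurable with
`F(σ) e^{λσ}/σ^m → C` and `kλ < ω`, then `expConv ω k F s · e^{λs}/s^m → C/(ω - kλ)`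
(the exponent pair `(λ, m)` is kept). [cite: Lin2017, Prop. 2.1] -/
theorem tendsto_expConv_of_gt (hk : 0 < k) (hω : 0 < ω) (hlam : k * lam < ω)
    (hFm : Measurable F) (hF0 : ∀ σ, 0 ≤ F σ) (hFP : ∀ σ, F σ ≤ P)
    (hR : Tendsto (fun σ => F σ * Real.exp (lam * σ) / σ ^ m) atTop (𝓝 C)) :
    Tendsto (fun s => (∫ y in Ioi (0 : ℝ), Real.exp (-(ω * y)) * F (s - k * y)) *
      Real.exp (lam * s) / s ^ m) atTop (𝓝 (C / (ω - k * lam))) := by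
  obtain ⟨σ₀, hσ₀1, hσ₀⟩ := exists_ratio_near hR
  have hc : 0 < ω - k * lam := by linarith
  have hP0 : 0 ≤ P := (hF0 0).trans (hFP 0)
  -- the normalised integrand
  set Φ : ℝ → ℝ → ℝ := fun s y =>
    Real.exp (-(ω * y)) * F (s - k * y) * Real.exp (lam * s) / s ^ m with hΦ
  have hΦm : ∀ s, Measurable (Φ s) := fun s => by
    simp only [hΦ]
    fun_prop
  have hΦ0 : ∀ s y, 0 < s → 0 ≤ Φ s y := fun s y hs => by
    simp only [hΦ]
    have := hF0 (s - k * y)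
    positivity
  have hΦint : ∀ s, IntegrableOn (Φ s) (Ioi 0) := fun s => by
    have h := (integrableOn_integrand (k := k) hω hFm hF0 hFP s).mul_const
      (Real.exp (lam * s) / s ^ m)
    refine IntegrableOn.congr_fun h (fun y _ => ?_) measurableSet_Ioi
    simp only [hΦ]
    ring
  have hratio : ∀ s, (∫ y in Ioi (0 : ℝ), Real.exp (-(ω * y)) * F (s - k * y)) *
      Real.exp (lam * s) / s ^ m = ∫ y in Ioi (0 : ℝ), Φ s y := by
    intro s
    rw [← integral_mul_const, ← integral_div]
  -- exponential bookkeeping: `e^{-ωy} e^{λs} = e^{λ(s-ky)} e^{-(ω-kλ)y}`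
  have hexp : ∀ s y : ℝ, Real.exp (-(ω * y)) * Real.exp (lam * s) =
      Real.exp (lam * (s - k * y)) * Real.exp (-((ω - k * lam) * y)) := fun s y => by
    rw [← Real.exp_add, ← Real.exp_add]
    congr 1
    ring
  have hexp3 : ∀ s y : ℝ, Real.exp (-(ω * y)) * Real.exp (-(lam * (s - k * y))) *
      Real.exp (lam * s) = Real.exp (-((ω - k * lam) * y)) := fun s y => by
    rw [← Real.exp_add, ← Real.exp_add]
    congr 1
    ring
  -- the main part `y < (s - σ₀)/k`: dominated convergence
  have hmain : Tendsto (fun s => ∫ y in Ioi (0 : ℝ), (Iio ((s - σ₀) / k)).indicator (Φ s) y)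
      atTop (𝓝 (∫ y in Ioi (0 : ℝ), C * Real.exp (-((ω - k * lam) * y)))) := by
    refine tendsto_integral_filter_of_dominated_convergence
      (fun y => (|C| + 1) * Real.exp (-((ω - k * lam) * y))) ?_ ?_ ?_ ?_
    · exact Eventually.of_forall fun s =>
        ((hΦm s).indicator measurableSet_Iio).aestronglyMeasurable
    · filter_upwards [eventually_gt_atTop σ₀] with s hs
      rw [ae_restrict_iff' measurableSet_Ioi]
      refine Eventually.of_forall fun y (hy : 0 < y) => ?_
      have hspos : 0 < s := by linarith
      rw [Real.norm_eq_abs]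
      by_cases hyI : y ∈ Iio ((s - σ₀) / k)
      · rw [indicator_of_mem hyI, abs_of_nonneg (hΦ0 s y hspos)]
        have hσ : σ₀ ≤ s - k * y := by
          rw [mem_Iio, lt_div_iff₀ hk] at hyI
          linarith
        have hσpos : 0 < s - k * y := by linarith
        have hle1 : ((s - k * y) / s) ^ m ≤ 1 :=
          pow_le_one₀ (by positivity) ((div_le_one hspos).2 (by nlinarith))
        calc Φ s y = Real.exp (-(ω * y)) * F (s - k * y) * Real.exp (lam * s) / s ^ m := rfl
          _ ≤ Real.exp (-(ω * y)) * ((|C| + 1) * (s - k * y) ^ m * Real.exp (-(lam * (s - k * y))))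
              * Real.exp (lam * s) / s ^ m := by
              gcongr
              exact le_of_ratio_near hσ₀1 hσ₀ hσ
          _ = (|C| + 1) * (s - k * y) ^ m * (Real.exp (-(ω * y)) *
              Real.exp (-(lam * (s - k * y))) * Real.exp (lam * s)) / s ^ m := by ring
          _ = (|C| + 1) * Real.exp (-((ω - k * lam) * y)) * ((s - k * y) / s) ^ m := by
              rw [hexp3 s y, div_pow]
              ring
          _ ≤ (|C| + 1) * Real.exp (-((ω - k * lam) * y)) :=
              mul_le_of_le_one_right (by positivity) hle1
      · rw [indicator_of_notMem hyI, abs_zero]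
        positivity
    · exact integrableOn_const_mul_exp_neg hc (|C| + 1)
    · rw [ae_restrict_iff' measurableSet_Ioi]
      refine Eventually.of_forall fun y (hy : 0 < y) => ?_
      have h1 : Tendsto (fun s : ℝ => s - k * y) atTop atTop :=
        tendsto_atTop_atTop.2 fun b => ⟨b + k * y, fun s hs => by linarith⟩
      have h2 : Tendsto (fun s : ℝ => ((s - k * y) / s) ^ m) atTop (𝓝 1) := by
        have h3 : Tendsto (fun s : ℝ => 1 - k * y / s) atTop (𝓝 (1 - 0)) :=
          tendsto_const_nhds.sub (tendsto_const_nhds.div_atTop tendsto_id)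
        rw [sub_zero] at h3
        have h4 : Tendsto (fun s : ℝ => (s - k * y) / s) atTop (𝓝 1) := by
          refine h3.congr' ?_
          filter_upwards [eventually_ne_atTop 0] with s hs
          field_simp
        simpa using h4.pow m
      have h5 := (hR.comp h1).mul (h2.const_mul (Real.exp (-((ω - k * lam) * y))))
      simp only [mul_one] at h5
      have h6 : Tendsto (fun s : ℝ => F (s - k * y) * Real.exp (lam * (s - k * y)) / (s - k * y) ^ m *
          (Real.exp (-((ω - k * lam) * y)) * ((s - k * y) / s) ^ m)) atTop
          (𝓝 (C * Real.exp (-((ω - k * lam) * y)))) := h5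
      refine h6.congr' ?_
      filter_upwards [eventually_gt_atTop (k * y + σ₀)] with s hs
      have hyI : y ∈ Iio ((s - σ₀) / k) := by
        rw [mem_Iio, lt_div_iff₀ hk]
        linarith
      have hσpos : 0 < s - k * y := by linarith
      have hσne : (s - k * y) ^ m ≠ 0 := pow_ne_zero _ hσpos.ne'
      rw [indicator_of_mem hyI]
      simp only [hΦ]
      rw [div_pow]
      calc F (s - k * y) * Real.exp (lam * (s - k * y)) / (s - k * y) ^ m *
            (Real.exp (-((ω - k * lam) * y)) * ((s - k * y) ^ m / s ^ m))
          = F (s - k * y) * (Real.exp (lam * (s - k * y)) * Real.exp (-((ω - k * lam) * y))) /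
              s ^ m * ((s - k * y) ^ m / (s - k * y) ^ m) := by ring
        _ = F (s - k * y) * (Real.exp (-(ω * y)) * Real.exp (lam * s)) / s ^ m := by
            rw [← hexp s y, div_self hσne, mul_one]
        _ = Real.exp (-(ω * y)) * F (s - k * y) * Real.exp (lam * s) / s ^ m := by ring
  -- the tail `y ≥ (s - σ₀)/k` tends to zero
  have htail : Tendsto (fun s => ∫ y in Ioi (0 : ℝ), (Ici ((s - σ₀) / k)).indicator (Φ s) y)
      atTop (𝓝 0) := by
    have hbound : Tendsto (fun s : ℝ => P * Real.exp (ω / k * σ₀) / ω *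
        Real.exp (-((ω / k - lam) * s))) atTop (𝓝 (P * Real.exp (ω / k * σ₀) / ω * 0)) := by
      refine tendsto_const_nhds.mul ?_
      have hpos : 0 < ω / k - lam := by
        rw [sub_pos, lt_div_iff₀ hk, mul_comm]
        exact hlam
      exact Real.tendsto_exp_neg_atTop_nhds_zero.comp (tendsto_id.const_mul_atTop hpos)
    rw [mul_zero] at hbound
    refine tendsto_of_tendsto_of_tendsto_of_le_of_le' tendsto_const_nhds hbound ?_ ?_
    · filter_upwards [eventually_gt_atTop σ₀] with s hs
      have hspos : 0 < s := by linarith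
      exact setIntegral_nonneg measurableSet_Ioi fun y _ =>
        Set.indicator_nonneg (fun y _ => hΦ0 s y hspos) _
    · filter_upwards [eventually_gt_atTop σ₀] with s hs
      have hspos : 0 < s := by linarith
      have ha : 0 < (s - σ₀) / k := div_pos (by linarith) hk
      have hs1 : 1 ≤ s := by linarith
      calc (∫ y in Ioi (0 : ℝ), (Ici ((s - σ₀) / k)).indicator (Φ s) y)
            ≤ ∫ y in Ioi (0 : ℝ), (Ici ((s - σ₀) / k)).indicator
                (fun y => P * Real.exp (lam * s) / s ^ m * Real.exp (-(ω * y))) y := by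
              refine integral_mono_of_nonneg (Eventually.of_forall fun y =>
                Set.indicator_nonneg (fun y _ => hΦ0 s y hspos) _)
                ((integrableOn_const_mul_exp_neg hω _).indicator measurableSet_Ici)
                (Eventually.of_forall fun y => Set.indicator_le_indicator ?_)
              simp only [hΦ]
              have h1 : F (s - k * y) ≤ P := hFP _
              calc Real.exp (-(ω * y)) * F (s - k * y) * Real.exp (lam * s) / s ^ m
                    ≤ Real.exp (-(ω * y)) * P * Real.exp (lam * s) / s ^ m := by gcongr
                _ = P * Real.exp (lam * s) / s ^ m * Real.exp (-(ω * y)) := by ring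
        _ = P * Real.exp (lam * s) / s ^ m * (Real.exp (-(ω * ((s - σ₀) / k))) / ω) :=
              integral_indicator_Ici_exp_neg hω ha _
        _ ≤ P * Real.exp (lam * s) / 1 * (Real.exp (-(ω * ((s - σ₀) / k))) / ω) := by
              gcongr
              exact one_le_pow₀ hs1
        _ = P * Real.exp (ω / k * σ₀) / ω * Real.exp (-((ω / k - lam) * s)) := by
              have : Real.exp (lam * s) * Real.exp (-(ω * ((s - σ₀) / k))) =
                  Real.exp (ω / k * σ₀) * Real.exp (-((ω / k - lam) * s)) := by
                rw [← Real.exp_add, ← Real.exp_add]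
                congr 1
                field_simp
                ring
              rw [div_one]
              calc P * Real.exp (lam * s) * (Real.exp (-(ω * ((s - σ₀) / k))) / ω)
                    = P * (Real.exp (lam * s) * Real.exp (-(ω * ((s - σ₀) / k)))) / ω := by ring
                _ = P * Real.exp (ω / k * σ₀) / ω * Real.exp (-((ω / k - lam) * s)) := by
                    rw [this]
                    ring
  -- assemble
  have hlim : ∫ y in Ioi (0 : ℝ), C * Real.exp (-((ω - k * lam) * y)) = C / (ω - k * lam) := by
    rw [integral_const_mul, integral_exp_neg_mul_Ioi hc, mul_one_div]
  rw [hlim] at hmain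
  have hsum := hmain.add htail
  rw [add_zero] at hsum
  refine hsum.congr' (Eventually.of_forall fun s => ?_)
  dsimp only
  rw [hratio s, ← integral_add' ((hΦint s).indicator measurableSet_Iio)
    ((hΦint s).indicator measurableSet_Ici)]
  refine setIntegral_congr_fun measurableSet_Ioi fun y _ => ?_
  rw [← compl_Iio]
  exact congrFun (Set.indicator_self_add_compl (Iio ((s - σ₀) / k)) (Φ s)) y

end CaseGT

/-! ## Case `r` equal to the decay rate of `F` -/

section CaseEQ

variable {ω k P C : ℝ} {m : ℕ} {F : ℝ → ℝ}

/-- `∫_0^1 C (1-u)^m du = C/(m+1)`, as an integral over `(0,∞)` of an indicator. [folklore] -/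
theorem integral_indicator_Iio_one_sub_pow (m : ℕ) (C : ℝ) :
    ∫ u in Ioi (0 : ℝ), (Iio (1 : ℝ)).indicator (fun u => C * (1 - u) ^ m) u = C / (m + 1) := by
  rw [integral_indicator measurableSet_Iio, Measure.restrict_restrict measurableSet_Iio,
    show Iio (1 : ℝ) ∩ Ioi 0 = Ioo 0 1 from by ext u; simp [and_comm],
    ← integral_Ioc_eq_integral_Ioo, ← intervalIntegral.integral_of_le zero_le_one,
    intervalIntegral.integral_const_mul, intervalIntegral.integral_comp_sub_left (fun x => x ^ m) 1,
    sub_self, sub_zero, integral_pow]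
  simp [div_eq_mul_inv]

/-- `∫_{u ≥ b} Q e^{r s (1-u)} du = Q e^{rs(1-b)}/(rs)` over `(0,∞)` for `b > 0`, `rs > 0`.
[folklore] -/
theorem integral_indicator_Ici_exp_affine {r s b : ℝ} (hrs : 0 < r * s) (hb : 0 < b) (Q : ℝ) :
    ∫ u in Ioi (0 : ℝ), (Ici b).indicator (fun u => Q * Real.exp (r * (s * (1 - u)))) u =
      Q * (Real.exp (r * (s * (1 - b))) / (r * s)) := by
  rw [integral_indicator measurableSet_Ici, Measure.restrict_restrict measurableSet_Ici,
    (inter_eq_left (s := Ici b) (t := Ioi 0)).2 (fun y hy => mem_Ioi.2 (hb.trans_le hy)),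
    integral_const_mul, integral_Ici_eq_integral_Ioi]
  have he : (fun u : ℝ => Real.exp (r * (s * (1 - u)))) =
      fun u => Real.exp (r * s) * Real.exp (-(r * s) * u) := by
    funext u
    rw [← Real.exp_add]
    congr 1
    ring
  rw [he, integral_const_mul, integral_exp_mul_Ioi (by linarith) b, neg_mul, neg_div_neg_eq,
    ← mul_div_assoc, ← Real.exp_add]
  congr 2
  ring

/-- **Step, case `r = ω/k` equal to the decay rate of `F`.** If `0 ≤ F ≤ P` is measurable with
`F(σ) e^{rσ}/σ^m → C`, `r = ω/k`, then `expConv ω k F s · e^{rs}/s^{m+1} → C/(k(m+1))`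
(the multiplicity goes up by one). [cite: Lin2017, Prop. 2.1] -/
theorem tendsto_expConv_of_eq (hk : 0 < k) (hω : 0 < ω)
    (hFm : Measurable F) (hF0 : ∀ σ, 0 ≤ F σ) (hFP : ∀ σ, F σ ≤ P)
    (hR : Tendsto (fun σ => F σ * Real.exp (ω / k * σ) / σ ^ m) atTop (𝓝 C)) :
    Tendsto (fun s => (∫ y in Ioi (0 : ℝ), Real.exp (-(ω * y)) * F (s - k * y)) *
      Real.exp (ω / k * s) / s ^ (m + 1)) atTop (𝓝 (C / (k * (m + 1)))) := by
  set r := ω / k with hr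
  have hrpos : 0 < r := div_pos hω hk
  obtain ⟨σ₀, hσ₀1, hσ₀⟩ := exists_ratio_near hR
  have hσ₀pos : 0 < σ₀ := by linarith
  have hP0 : 0 ≤ P := (hF0 0).trans (hFP 0)
  -- the substituted, normalised integrand
  set Ψ : ℝ → ℝ → ℝ := fun s u =>
    Real.exp (r * (s * (1 - u))) * F (s * (1 - u)) / s ^ m with hΨ
  have hΨm : ∀ s, Measurable (Ψ s) := fun s => by
    simp only [hΨ]
    fun_prop
  have hΨ0 : ∀ s u, 0 < s → 0 ≤ Ψ s u := fun s u hs => by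
    simp only [hΨ]
    have := hF0 (s * (1 - u))
    positivity
  have hΨle : ∀ s u, 0 < s → Ψ s u ≤ P / s ^ m * Real.exp (r * (s * (1 - u))) := fun s u hs => by
    simp only [hΨ]
    calc Real.exp (r * (s * (1 - u))) * F (s * (1 - u)) / s ^ m
          ≤ Real.exp (r * (s * (1 - u))) * P / s ^ m := by
            gcongr
            exact hFP _
      _ = P / s ^ m * Real.exp (r * (s * (1 - u))) := by ring
  have hdomint : ∀ s, 0 < s →
      IntegrableOn (fun u => P / s ^ m * Real.exp (r * (s * (1 - u)))) (Ioi (0 : ℝ)) := by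
    intro s hs
    have h := integrableOn_const_mul_exp_neg (mul_pos hrpos hs) (P / s ^ m * Real.exp (r * s))
    refine IntegrableOn.congr_fun h (fun u _ => ?_) measurableSet_Ioi
    rw [mul_assoc, ← Real.exp_add]
    congr 2
    ring
  have hΨint : ∀ s, 0 < s → IntegrableOn (Ψ s) (Ioi 0) := fun s hs => by
    refine Integrable.mono' (hdomint s hs) (hΨm s).aestronglyMeasurable ?_
    refine Eventually.of_forall fun u => ?_
    rw [Real.norm_eq_abs, abs_of_nonneg (hΨ0 s u hs)]
    exact hΨle s u hs
  -- the substitution `y = (s/k) u`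
  have hsubst : ∀ s, 0 < s →
      (∫ y in Ioi (0 : ℝ), Real.exp (-(ω * y)) * F (s - k * y)) * Real.exp (r * s) /
        s ^ (m + 1) = 1 / k * ∫ u in Ioi (0 : ℝ), Ψ s u := by
    intro s hs
    have hb : 0 < s / k := div_pos hs hk
    have h := integral_comp_mul_left_Ioi (fun y => Real.exp (-(ω * y)) * F (s - k * y)) 0 hb
    rw [mul_zero, smul_eq_mul] at h
    have h' : (∫ y in Ioi (0 : ℝ), Real.exp (-(ω * y)) * F (s - k * y)) =
        s / k * ∫ u in Ioi (0 : ℝ), Real.exp (-(ω * (s / k * u))) * F (s - k * (s / k * u)) := by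
      rw [h, ← mul_assoc, mul_inv_cancel₀ hb.ne', one_mul]
    have hI : (∫ y in Ioi (0 : ℝ), Real.exp (-(ω * y)) * F (s - k * y)) * Real.exp (r * s) /
        s ^ (m + 1) =
        1 / k * ((∫ u in Ioi (0 : ℝ), Real.exp (-(ω * (s / k * u))) * F (s - k * (s / k * u))) *
          (Real.exp (r * s) / s ^ m)) := by
      rw [h', pow_succ]
      field_simp
    rw [hI, ← integral_mul_const]
    congr 1
    refine setIntegral_congr_fun measurableSet_Ioi fun u _ => ?_
    have e1 : s - k * (s / k * u) = s * (1 - u) := by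
      field_simp
    have e2 : Real.exp (-(ω * (s / k * u))) * Real.exp (r * s) = Real.exp (r * (s * (1 - u))) := by
      rw [← Real.exp_add]
      congr 1
      rw [hr]
      field_simp
      ring
    simp only [hΨ]
    rw [e1]
    calc Real.exp (-(ω * (s / k * u))) * F (s * (1 - u)) * (Real.exp (r * s) / s ^ m)
        = Real.exp (-(ω * (s / k * u))) * Real.exp (r * s) * F (s * (1 - u)) / s ^ m := by ring
      _ = Real.exp (r * (s * (1 - u))) * F (s * (1 - u)) / s ^ m := by rw [e2]
  -- main part `u < 1 - σ₀/s`: dominated convergence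
  have hmain : Tendsto (fun s => ∫ u in Ioi (0 : ℝ), (Iio (1 - σ₀ / s)).indicator (Ψ s) u)
      atTop (𝓝 (∫ u in Ioi (0 : ℝ), (Iio (1 : ℝ)).indicator (fun u => C * (1 - u) ^ m) u)) := by
    refine tendsto_integral_filter_of_dominated_convergence
      ((Iio (1 : ℝ)).indicator fun _ => |C| + 1) ?_ ?_ ?_ ?_
    · exact Eventually.of_forall fun s =>
        ((hΨm s).indicator measurableSet_Iio).aestronglyMeasurable
    · filter_upwards [eventually_gt_atTop σ₀] with s hs
      have hspos : 0 < s := by linarith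
      rw [ae_restrict_iff' measurableSet_Ioi]
      refine Eventually.of_forall fun u (hu : 0 < u) => ?_
      rw [Real.norm_eq_abs]
      by_cases huI : u ∈ Iio (1 - σ₀ / s)
      · have hu1 : u < 1 := by
          have : 0 < σ₀ / s := div_pos hσ₀pos hspos
          exact lt_of_lt_of_le huI (by linarith)
        rw [indicator_of_mem huI, indicator_of_mem (mem_Iio.2 hu1), abs_of_nonneg (hΨ0 s u hspos)]
        have hσ : σ₀ ≤ s * (1 - u) := by
          have h1 : σ₀ / s < 1 - u := by
            have := mem_Iio.1 huI
            linarith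
          rw [div_lt_iff₀ hspos] at h1
          linarith
        calc Ψ s u = Real.exp (r * (s * (1 - u))) * F (s * (1 - u)) / s ^ m := rfl
          _ ≤ Real.exp (r * (s * (1 - u))) *
                ((|C| + 1) * (s * (1 - u)) ^ m * Real.exp (-(r * (s * (1 - u))))) / s ^ m := by
              gcongr
              exact le_of_ratio_near hσ₀1 hσ₀ hσ
          _ = (|C| + 1) * (1 - u) ^ m := by
              rw [mul_pow, Real.exp_neg]
              field_simp
          _ ≤ |C| + 1 :=
              mul_le_of_le_one_right (by positivity)
                (pow_le_one₀ (by linarith) (by linarith))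
      · rw [indicator_of_notMem huI, abs_zero]
        exact Set.indicator_nonneg (fun _ _ => by positivity) _
    · exact (integrable_indicator_iff measurableSet_Iio).2
        (integrableOn_const (by
          rw [Measure.restrict_apply measurableSet_Iio]
          exact ne_top_of_le_ne_top (by simp : volume (Ioo (0 : ℝ) 1) ≠ ⊤)
            (measure_mono fun u hu => ⟨hu.2, hu.1⟩)))
    · rw [ae_restrict_iff' measurableSet_Ioi]
      refine Eventually.of_forall fun u (hu : 0 < u) => ?_
      by_cases hu1 : u < 1
      · rw [indicator_of_mem (mem_Iio.2 hu1)]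
        have h1 : Tendsto (fun s : ℝ => s * (1 - u)) atTop atTop :=
          tendsto_id.atTop_mul_const (by linarith)
        have h2 := (hR.comp h1).mul_const ((1 - u) ^ m)
        refine h2.congr' ?_
        filter_upwards [eventually_gt_atTop (σ₀ / (1 - u)), eventually_gt_atTop 0] with s hs hspos
        have huI : u ∈ Iio (1 - σ₀ / s) := by
          rw [mem_Iio]
          rw [div_lt_iff₀ (by linarith : (0 : ℝ) < 1 - u)] at hs
          have : σ₀ / s < 1 - u := by
            rw [div_lt_iff₀ hspos]
            linarith
          linarith
        rw [indicator_of_mem huI]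
        simp only [hΨ, Function.comp_apply]
        have hne : (1 - u) ^ m ≠ 0 := pow_ne_zero _ (by linarith)
        rw [mul_pow]
        field_simp
      · have hlim0 : (Iio (1 : ℝ)).indicator (fun u => C * (1 - u) ^ m) u = 0 :=
          indicator_of_notMem (by simpa using hu1) _
        rw [hlim0]
        refine tendsto_const_nhds.congr' ?_
        filter_upwards [eventually_gt_atTop 0] with s hspos
        have huI : u ∉ Iio (1 - σ₀ / s) := by
          rw [mem_Iio, not_lt]
          have : 0 < σ₀ / s := div_pos hσ₀pos hspos
          linarith
        rw [indicator_of_notMem huI]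
  -- the tail `u ≥ 1 - σ₀/s` tends to zero
  have htail : Tendsto (fun s => ∫ u in Ioi (0 : ℝ), (Ici (1 - σ₀ / s)).indicator (Ψ s) u)
      atTop (𝓝 0) := by
    have hbound : Tendsto (fun s : ℝ => P * Real.exp (r * σ₀) / r * s⁻¹) atTop
        (𝓝 (P * Real.exp (r * σ₀) / r * 0)) :=
      tendsto_const_nhds.mul tendsto_inv_atTop_zero
    rw [mul_zero] at hbound
    refine tendsto_of_tendsto_of_tendsto_of_le_of_le' tendsto_const_nhds hbound ?_ ?_
    · filter_upwards [eventually_gt_atTop σ₀] with s hs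
      have hspos : 0 < s := by linarith
      exact setIntegral_nonneg measurableSet_Ioi fun u _ =>
        Set.indicator_nonneg (fun u _ => hΨ0 s u hspos) _
    · filter_upwards [eventually_gt_atTop σ₀] with s hs
      have hspos : 0 < s := by linarith
      have hs1 : 1 ≤ s := by linarith
      have hb : 0 < 1 - σ₀ / s := by
        rw [sub_pos, div_lt_one hspos]
        exact hs
      calc (∫ u in Ioi (0 : ℝ), (Ici (1 - σ₀ / s)).indicator (Ψ s) u)
            ≤ ∫ u in Ioi (0 : ℝ), (Ici (1 - σ₀ / s)).indicator
                (fun u => P / s ^ m * Real.exp (r * (s * (1 - u)))) u :=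
              integral_mono_of_nonneg (Eventually.of_forall fun u =>
                Set.indicator_nonneg (fun u _ => hΨ0 s u hspos) _)
                ((hdomint s hspos).indicator measurableSet_Ici)
                (Eventually.of_forall fun u => Set.indicator_le_indicator (hΨle s u hspos))
        _ = P / s ^ m * (Real.exp (r * (s * (1 - (1 - σ₀ / s)))) / (r * s)) :=
              integral_indicator_Ici_exp_affine (mul_pos hrpos hspos) hb _
        _ = P * Real.exp (r * σ₀) / r * (s ^ m * s)⁻¹ := by
              have : s * (1 - (1 - σ₀ / s)) = σ₀ := by
                field_simp
                ring
              rw [this]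
              field_simp
        _ ≤ P * Real.exp (r * σ₀) / r * s⁻¹ := by
              gcongr
              exact le_mul_of_one_le_left hspos.le (one_le_pow₀ hs1)
  -- assemble
  rw [integral_indicator_Iio_one_sub_pow] at hmain
  have hsum := (hmain.add htail).const_mul (1 / k)
  rw [add_zero] at hsum
  have hval : 1 / k * (C / (m + 1)) = C / (k * (m + 1)) := by
    field_simp
  rw [hval] at hsum
  refine hsum.congr' ?_
  filter_upwards [eventually_gt_atTop 0] with s hspos
  rw [hsubst s hspos, ← integral_add' ((hΨint s hspos).indicator measurableSet_Iio)
    ((hΨint s hspos).indicator measurableSet_Ici)]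
  congr 1
  refine setIntegral_congr_fun measurableSet_Ioi fun u _ => ?_
  rw [← compl_Iio]
  exact congrFun (Set.indicator_self_add_compl (Iio (1 - σ₀ / s)) (Ψ s)) u

end CaseEQ

end Literature.Analysis.Asymptotics.ExpTail

end
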